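import Literature.NumberTheory.Rogawski1990.KottwitzSignDiagonalModel
import Literature.NumberTheory.Rogawski1990.CartanInvariant
import HarnessLib

/-!
# Kottwitz signs, IX: the sign of a split-singular element in a BLOCK frame — the twisted eigenplane, its determinant and the norm class
# (Rogawski 1990, §3.8 Prop. 3.8.1 (a)(d) p. 37; §4.1 (4.1.2) pp. 39–40; §8.2 p. 117; Kottwitz 1983, 1986 §9)

Topic `NumberTheory/Rogawski1990`; namespace `Literature.NumberTheory.Rogawski1990`.  THEOREMS ONLY (no definition, no named fact, no instance,
no notation, no `sorry`).  Cell `pub/hodgecm-mathlib`, ENGINE T1 (crux H413 = `stmt-HodgeConjecture-24833`), row O7 «singular semisimple classes»,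
O7 OWNER WORD #43 row (d) «THE SIGN WEIGHT READS THE OBSTRUCTION»: the FIELD-LEVEL core of the local flip `e_v(x) = e_v((γ₀)_v) · (θ, blockDet_v)_v`.
Sequel of ★ `KottwitzSignDiagonalModel` (the diagonal model `diag(t₀,t₁,t₂)`), generalised to the BLOCK model `B ⊕ᶠ (c)` that the twisted Gram
matrix `ᵗ(σ(gP)) H (gP)` of an ADELIC conjugate `g γ₀ g⁻¹` takes in the rational frame `P` of `γ₀` (its plane block `B = H_a · y₁` is no longer
diagonal; ★ `exists_twistGram_frame_eq_finSum`).  HC_CM is proved only modulo the printed citations until rung 0 closes; nothing printed is consumed here.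

## What is proved

* §1 `finSum_two_one_eq` (the block matrix in coordinates), `hermForm_two` (a binary hermitian form in coordinates).
* §2 **`exists_isotropic_iff_exists_mul_self_eq_neg_det`** — over a FIELD `K` with a ring endomorphism `σ`, for a `σ`-hermitian binary Gram
  matrix `B` (`ᵗ(σB) = B`; no non-degeneracy needed): the plane is ISOTROPIC iff `−det B` is a NORM `σ(z) z` (completing the square:
  `B₀₀ · ⟨u,u⟩ = N(B₀₀ u₀ + B₀₁ u₁) + det B · N(u₁)`).  This is the rank-2 case of the classification of hermitian forms over a local field by
  the norm class of the determinant [Jacobowitz 1962, Thm. 3.1], in the only direction and generality the sign needs (no field hypothesis beyond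
  `Field K`; over `ℂ` with complex conjugation it says: anisotropic iff `det B > 0`).
* §3 **`hasIsotropicEigenvector_finSum_iff`** (any commutative ring; `a − b` a unit): for the Gram matrix `B ⊕ᶠ C` and `D = diag(a, a, b)` an
  isotropic eigenvector exists iff the PLANE `B` is isotropic or `C₀₀ σ(z) z = 0` for some `z ≠ 0` (★ `hasIsotropicEigenvector_diagonal_iff` is the
  case `B` diagonal).
* §4 **`kottwitzSign_finSum_diagonal_eq_neg_one_iff`** (field): `e_{B ⊕ᶠ C}(diag(a,a,b)) = −1 ↔ ¬ ∃ z, σ(z) z = −det B` (`C₀₀ ≠ 0`).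
* §5 transports: **`kottwitzSign_conj_eq_twistGram`** (`e_H(g X g⁻¹) = e_{ᵗ(σg) H g}(X)`, ★ `kottwitzSign_congr`) and **`kottwitzSign_eq_of_frame'`**
  (★ `kottwitzSign_eq_of_frame` with an arbitrary framed Gram matrix `M` in place of `diag t`).

## References
* [Rogawski1990] J. D. Rogawski, *Automorphic Representations of Unitary Groups in Three Variables*, Ann. of Math. Stud. 123 (1990), §3.8 Prop. 3.8.1
  (a)(d) p. 37; §4.1 (4.1.2) pp. 39–40; §8.2 p. 117.
* [Kottwitz1983] R. E. Kottwitz, *Sign changes in harmonic analysis on reductive groups*, Trans. AMS 278 (1983), 289–297.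
* [Kottwitz1986] R. E. Kottwitz, *Stable trace formula: elliptic singular terms*, Math. Ann. 275 (1986), §9.
* [Jacobowitz1962] R. Jacobowitz, *Hermitian forms over local fields*, Amer. J. Math. 84 (1962), §3 Thm. 3.1.
-/

set_option autoImplicit false

noncomputable section

open Matrix
open scoped MatrixGroups

namespace Literature.NumberTheory.Rogawski1990

open Literature.AlgebraicGeometry.ShimuraVarieties (hermForm)
open Literature.NumberTheory.Automorphic.UnitaryGroup (finSum)

/-! ## §1 The block model in coordinates -/

section Coordinates

variable {R : Type*} [CommRing R] (σ : R →+* R)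

/-- `B ⊕ᶠ C` in coordinates (`B` a `2 × 2` block, `C` a `1 × 1` block). [cite: Rogawski1990, §3.8 Prop. 3.8.1 p. 37] -/
theorem finSum_two_one_eq (B : Matrix (Fin 2) (Fin 2) R) (C : Matrix (Fin 1) (Fin 1) R) :
    finSum 2 1 B C = !![B 0 0, B 0 1, 0; B 1 0, B 1 1, 0; 0, 0, C 0 0] := by
  ext i j
  fin_cases i <;> fin_cases j <;> simp [finSum, Matrix.fromBlocks, finSumFinEquiv, Fin.addCases]

/-- A binary hermitian form in coordinates. [cite: Rogawski1990, §3.8 Prop. 3.8.1 p. 37] -/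
theorem hermForm_two (B : Matrix (Fin 2) (Fin 2) R) (u : Fin 2 → R) :
    hermForm σ B u u = B 0 0 * (σ (u 0) * u 0) + B 0 1 * (σ (u 0) * u 1) + B 1 0 * (σ (u 1) * u 0) + B 1 1 * (σ (u 1) * u 1) := by
  simp only [hermForm, dotProduct, Matrix.mulVec, Fin.sum_univ_two, Function.comp_apply]
  ring

/-- The block form in coordinates: `⟨v, v⟩_{B ⊕ᶠ C} = ⟨(v₀,v₁), (v₀,v₁)⟩_B + C₀₀ σ(v₂) v₂`. [cite: Rogawski1990, §3.8 Prop. 3.8.1 p. 37] -/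
theorem hermForm_finSum_two_one (B : Matrix (Fin 2) (Fin 2) R) (C : Matrix (Fin 1) (Fin 1) R) (v : Fin 3 → R) :
    hermForm σ (finSum 2 1 B C) v v = hermForm σ B ![v 0, v 1] ![v 0, v 1] + C 0 0 * (σ (v 2) * v 2) := by
  rw [finSum_two_one_eq, hermForm_two]
  simp [hermForm, dotProduct, Matrix.mulVec, Fin.sum_univ_three]
  ring

end Coordinates

/-! ## §2 A binary hermitian plane is isotropic iff `−det` is a norm -/

section Plane

variable {K : Type*} [Field K] (σ : K →+* K)

/-- **Completing the square**: `B₀₀ · ⟨u, u⟩_B = N(B₀₀ u₀ + B₀₁ u₁) + det B · N(u₁)` for a `σ`-hermitian `B` (`N(x) = σ(x) x`).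
[cite: Rogawski1990, §3.8 Prop. 3.8.1 (a) p. 37] [cite: Jacobowitz1962, §3 Thm. 3.1] -/
theorem mul_hermForm_two_eq (B : Matrix (Fin 2) (Fin 2) K) (hB : (B.map σ)ᵀ = B) (u : Fin 2 → K) :
    B 0 0 * hermForm σ B u u = σ (B 0 0 * u 0 + B 0 1 * u 1) * (B 0 0 * u 0 + B 0 1 * u 1) + B.det * (σ (u 1) * u 1) := by
  have h00 : σ (B 0 0) = B 0 0 := by simpa using congrFun (congrFun hB 0) 0
  have h01 : σ (B 0 1) = B 1 0 := by simpa using congrFun (congrFun hB 1) 0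
  rw [hermForm_two, Matrix.det_fin_two, map_add, map_mul, map_mul, h00, h01]
  ring

/-- **A binary `σ`-hermitian plane over a field is ISOTROPIC iff `−det` is a norm `σ(z) z`** (degenerate planes included: `0` is a norm).  (`→`: if `B₀₀ = 0` take `z = B₀₁`;
else `u₁ ≠ 0` and `z = (B₀₀ u₀ + B₀₁ u₁) / u₁`.  `←`: if `B₀₀ = 0` the first basis vector is isotropic; else `u = ((z − B₀₁)/B₀₀, 1)`.)
[cite: Rogawski1990, §3.8 Prop. 3.8.1 (a)(d) p. 37] [cite: Jacobowitz1962, §3 Thm. 3.1] -/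
theorem exists_isotropic_iff_exists_mul_self_eq_neg_det (B : Matrix (Fin 2) (Fin 2) K) (hB : (B.map σ)ᵀ = B) :
    (∃ u : Fin 2 → K, u ≠ 0 ∧ hermForm σ B u u = 0) ↔ ∃ z : K, σ z * z = -B.det := by
  have h01 : σ (B 0 1) = B 1 0 := by simpa using congrFun (congrFun hB 1) 0
  have hsq := mul_hermForm_two_eq σ B hB
  by_cases h0 : B 0 0 = 0
  · -- `B₀₀ = 0`: `e₀` is isotropic and `−det B = B₁₀ B₀₁ = σ(B₀₁) B₀₁`
    have hdet0 : -B.det = σ (B 0 1) * B 0 1 := by rw [Matrix.det_fin_two, h0, h01]; ring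
    refine ⟨fun _ => ⟨B 0 1, hdet0.symm⟩, fun _ => ⟨![1, 0], ?_, ?_⟩⟩
    · intro h; simpa using congrFun h 0
    · rw [hermForm_two]; simp [h0]
  · constructor
    · rintro ⟨u, hu0, hu⟩
      have key : σ (B 0 0 * u 0 + B 0 1 * u 1) * (B 0 0 * u 0 + B 0 1 * u 1) = -B.det * (σ (u 1) * u 1) := by
        have h := hsq u
        rw [hu, mul_zero] at h
        linear_combination -h
      by_cases hu1 : u 1 = 0
      · -- then `N(B₀₀ u₀) = 0`, so `u₀ = 0`: contradiction
        exfalso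
        rw [hu1, map_zero, zero_mul, mul_zero, mul_zero, add_zero] at key
        rcases mul_eq_zero.1 key with h | h
        · rw [map_eq_zero_iff σ σ.injective] at h
          exact hu0 (by ext i; fin_cases i <;> simp_all)
        · exact hu0 (by ext i; fin_cases i <;> simp_all)
      · refine ⟨(B 0 0 * u 0 + B 0 1 * u 1) * (u 1)⁻¹, ?_⟩
        have hσ1 : σ (u 1) ≠ 0 := (map_ne_zero_iff σ σ.injective).2 hu1
        rw [map_mul, map_inv₀]
        field_simp
        linear_combination key
    · rintro ⟨z, hz⟩
      refine ⟨![(z - B 0 1) * (B 0 0)⁻¹, 1], ?_, ?_⟩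
      · intro h; simpa using congrFun h 1
      · have h := hsq ![(z - B 0 1) * (B 0 0)⁻¹, 1]
        simp only [Matrix.cons_val_zero, Matrix.cons_val_one, map_one, mul_one] at h
        have e : B 0 0 * ((z - B 0 1) * (B 0 0)⁻¹) + B 0 1 = z := by field_simp; ring
        rw [e, hz, neg_add_cancel] at h
        exact (mul_eq_zero.1 h).resolve_left h0

/-- … equivalently: ANISOTROPIC iff `−det B` is NOT a norm. [cite: Rogawski1990, §3.8 Prop. 3.8.1 (a)(d) p. 37] [cite: Jacobowitz1962, §3 Thm. 3.1] -/
theorem forall_hermForm_eq_zero_iff_not_exists_mul_self_eq_neg_det (B : Matrix (Fin 2) (Fin 2) K) (hB : (B.map σ)ᵀ = B) :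
    (∀ u : Fin 2 → K, hermForm σ B u u = 0 → u = 0) ↔ ¬ ∃ z : K, σ z * z = -B.det := by
  rw [← exists_isotropic_iff_exists_mul_self_eq_neg_det σ B hB]
  push Not
  exact ⟨fun h u hu0 hu => hu0 (h u hu), fun h u hu => by_contra fun hu0 => h u hu0 hu⟩

end Plane

/-! ## §3 Isotropic eigenvectors in the block model (any commutative ring) -/

section Block

variable {R : Type*} [CommRing R] (σ : R →+* R)

/-- **Isotropic eigenvectors in the BLOCK model**: for `D = diag(a,a,b)`, `a − b` a unit, and the Gram matrix `B ⊕ᶠ C`, an `a`-eigenvector is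
`(u₀, u₁, 0)` and a `b`-eigenvector is `(0, 0, z)`, so an isotropic one exists iff the plane `B` is isotropic or `C₀₀ σ(z) z = 0` for some `z ≠ 0`.
[cite: Rogawski1990, §3.8 Prop. 3.8.1 p. 37; §8.2 p. 117] -/
theorem hasIsotropicEigenvector_finSum_iff {a b : R} (hab : IsUnit (a - b)) (B : Matrix (Fin 2) (Fin 2) R) (C : Matrix (Fin 1) (Fin 1) R) :
    HasIsotropicEigenvector σ (finSum 2 1 B C) (Matrix.diagonal ![a, a, b]) a b ↔
      (∃ u : Fin 2 → R, u ≠ 0 ∧ hermForm σ B u u = 0) ∨ (∃ z : R, z ≠ 0 ∧ C 0 0 * (σ z * z) = 0) := by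
  have hform := hermForm_finSum_two_one σ B C
  have hact : ∀ v : Fin 3 → R, Matrix.diagonal ![a, a, b] *ᵥ v = ![a * v 0, a * v 1, b * v 2] := by
    intro v
    ext i
    fin_cases i <;> simp [Matrix.mulVec_diagonal]
  have heigA : ∀ v : Fin 3 → R, Matrix.diagonal ![a, a, b] *ᵥ v = a • v ↔ v 2 = 0 := by
    intro v
    rw [hact]
    constructor
    · intro h
      have h2 := congrFun h 2
      simp only [Matrix.cons_val_two, Matrix.tail_cons, Matrix.head_cons, Pi.smul_apply, smul_eq_mul] at h2
      have h3 : (a - b) * v 2 = 0 := by rw [sub_mul, ← h2, sub_self]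
      exact (hab.mul_right_eq_zero).1 h3
    · intro h
      ext i
      fin_cases i <;> simp [h]
  have heigB : ∀ v : Fin 3 → R, Matrix.diagonal ![a, a, b] *ᵥ v = b • v ↔ v 0 = 0 ∧ v 1 = 0 := by
    intro v
    rw [hact]
    constructor
    · intro h
      have h0 := congrFun h 0
      have h1 := congrFun h 1
      simp only [Matrix.cons_val_zero, Matrix.cons_val_one, Pi.smul_apply, smul_eq_mul] at h0 h1
      have h0' : (a - b) * v 0 = 0 := by rw [sub_mul, h0, sub_self]
      have h1' : (a - b) * v 1 = 0 := by rw [sub_mul, h1, sub_self]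
      exact ⟨(hab.mul_right_eq_zero).1 h0', (hab.mul_right_eq_zero).1 h1'⟩
    · rintro ⟨h0, h1⟩
      ext i
      fin_cases i <;> simp [h0, h1]
  have hB0 : hermForm σ B ![0, 0] ![0, 0] = 0 := by rw [hermForm_two]; simp
  constructor
  · rintro ⟨v, hv0, hev, hiso⟩
    rw [hform] at hiso
    rcases hev with hev | hev
    · have h2 := (heigA v).1 hev
      left
      refine ⟨![v 0, v 1], ?_, ?_⟩
      · intro h0
        apply hv0
        have e0 := congrFun h0 0
        have e1 := congrFun h0 1
        simp only [Matrix.cons_val_zero, Matrix.cons_val_one, Pi.zero_apply] at e0 e1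
        ext i
        fin_cases i <;> simp [e0, e1, h2]
      · rw [h2, map_zero, zero_mul, mul_zero, add_zero] at hiso
        exact hiso
    · obtain ⟨h0, h1⟩ := (heigB v).1 hev
      right
      refine ⟨v 2, ?_, ?_⟩
      · intro hz
        apply hv0
        ext i
        fin_cases i <;> simp [h0, h1, hz]
      · rw [h0, h1, hB0, zero_add] at hiso
        exact hiso
  · rintro (⟨u, hu0, hu⟩ | ⟨z, hz0, hz⟩)
    · refine ⟨![u 0, u 1, 0], ?_, Or.inl ((heigA _).2 rfl), ?_⟩
      · intro h0
        apply hu0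
        have e0 := congrFun h0 0
        have e1 := congrFun h0 1
        simp only [Matrix.cons_val_zero, Matrix.cons_val_one, Pi.zero_apply] at e0 e1
        ext i
        fin_cases i <;> simp [e0, e1]
      · rw [hform]
        simp only [Matrix.cons_val_zero, Matrix.cons_val_one, Matrix.cons_val_two, Matrix.head_cons, Matrix.tail_cons, map_zero,
          mul_zero, add_zero]
        have hu' : (![u 0, u 1] : Fin 2 → R) = u := by ext i; fin_cases i <;> rfl
        rw [hu']
        exact hu
    · refine ⟨![0, 0, z], ?_, Or.inr ((heigB _).2 ⟨rfl, rfl⟩), ?_⟩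
      · intro h0
        apply hz0
        have e2 := congrFun h0 2
        simpa using e2
      · rw [hform]
        simp only [Matrix.cons_val_zero, Matrix.cons_val_one, Matrix.cons_val_two, Matrix.head_cons, Matrix.tail_cons]
        rw [hB0, zero_add]
        exact hz

end Block

/-! ## §4 The sign in the block model over a field -/

section Field

variable {K : Type*} [Field K] (σ : K →+* K)

/-- **THE SIGN IN THE BLOCK MODEL over a field**: for `a − b` a unit, a `σ`-hermitian plane block `B` and a non-zero line block
`C₀₀`, `e_{B ⊕ᶠ C}(diag(a,a,b)) = −1 ↔ −det B is NOT a norm σ(z) z` (the eigenLINE is never isotropic; the eigenPLANE is isotropic iff `−det B`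
is a norm, §2).  Over a non-split local field this is «`e = −1 ↔ (θ, −det B)_v = −1`»; over `ℂ`: «`e = −1 ↔ det B > 0`».
[cite: Rogawski1990, §4.1 (4.1.2) pp. 39–40; §8.2 p. 117] [cite: Kottwitz1986, §9] -/
theorem kottwitzSign_finSum_diagonal_eq_neg_one_iff {a b : K} (hab : IsUnit (a - b)) {B : Matrix (Fin 2) (Fin 2) K} (hB : (B.map σ)ᵀ = B)
    {C : Matrix (Fin 1) (Fin 1) K} (hC : C 0 0 ≠ 0) :
    kottwitzSign σ (finSum 2 1 B C) (Matrix.diagonal ![a, a, b]) = -1 ↔ ¬ ∃ z : K, σ z * z = -B.det := by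
  rw [kottwitzSign_eq_neg_one_iff_not_hasIsotropicEigenvector (isSplitSingular_diagonal hab), hasIsotropicEigenvector_finSum_iff σ hab,
    not_or, ← forall_hermForm_eq_zero_iff_not_exists_mul_self_eq_neg_det σ B hB]
  constructor
  · rintro ⟨h1, -⟩ u hu
    by_contra hu0
    exact h1 ⟨u, hu0, hu⟩
  · intro h
    refine ⟨fun ⟨u, hu0, hu⟩ => hu0 (h u hu), fun ⟨z, hz0, hz⟩ => ?_⟩
    rcases mul_eq_zero.1 hz with h1 | h1
    · exact hC h1
    · rcases mul_eq_zero.1 h1 with h2 | h2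
      · exact hz0 ((map_eq_zero_iff σ σ.injective).1 h2)
      · exact hz0 h2

end Field

/-! ## §5 Transports: conjugation and block frames -/

section Transport

variable {R : Type*} [CommRing R] {n : Type*} [Fintype n] [DecidableEq n] (σ : R →+* R) (H : Matrix n n R)

/-- **`e_H(g X g⁻¹) = e_{ᵗ(σg) H g}(X)`** — the sign of a conjugate for `H` is the sign of the original for the TWISTED Gram matrix `twistGram σ H g`
(★ `kottwitzSign_congr` at `T = g`; no unitarity of `g` needed). [cite: Rogawski1990, §4.1 (4.1.2) p. 39; §3.3 (3.3.1) p. 22] -/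
theorem kottwitzSign_conj_eq_twistGram (g : GL n R) (X : Matrix n n R) :
    kottwitzSign σ H ((g : Matrix n n R) * X * ((g⁻¹ : GL n R) : Matrix n n R)) = kottwitzSign σ (twistGram σ H (g : Matrix n n R)) X := by
  have hgi : ((g⁻¹ : GL n R) : Matrix n n R) * (g : Matrix n n R) = 1 := by rw [← Units.val_mul, inv_mul_cancel, Units.val_one]
  have h := kottwitzSign_congr (σ := σ) (H := H) g ((g : Matrix n n R) * X * ((g⁻¹ : GL n R) : Matrix n n R))
  have hX : ((g⁻¹ : GL n R) : Matrix n n R) * ((g : Matrix n n R) * X * ((g⁻¹ : GL n R) : Matrix n n R)) * (g : Matrix n n R) = X := by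
    calc ((g⁻¹ : GL n R) : Matrix n n R) * ((g : Matrix n n R) * X * ((g⁻¹ : GL n R) : Matrix n n R)) * (g : Matrix n n R)
        = (((g⁻¹ : GL n R) : Matrix n n R) * (g : Matrix n n R)) * X * (((g⁻¹ : GL n R) : Matrix n n R) * (g : Matrix n n R)) := by
          simp only [Matrix.mul_assoc]
      _ = X := by rw [hgi, Matrix.one_mul, Matrix.mul_one]
  rw [hX] at h
  rw [twistGram_def]
  exact h.symm

end Transport

section Frame

variable {R : Type*} [CommRing R] (σ : R →+* R)

/-- **Reduction of a framed element to a BLOCK model**: if `X P = P (a·1₂ ⊕ᶠ b·1₁)` and `ᵗ(σP) H P = M` then `e_H(X) = e_M(diag(a,a,b))`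
(★ `kottwitzSign_congr` with `T = P`; ★ `kottwitzSign_eq_of_frame` is the case `M = diag t`). [cite: Rogawski1990, §3.8 Prop. 3.8.1 p. 30; §4.1 (4.1.2) p. 39] -/
theorem kottwitzSign_eq_of_frame' (H : Matrix (Fin 3) (Fin 3) R) {X : Matrix (Fin 3) (Fin 3) R} (P : GL (Fin 3) R) {a b : R}
    (hXP : X * (P : Matrix (Fin 3) (Fin 3) R) =
      (P : Matrix (Fin 3) (Fin 3) R) * finSum 2 1 (a • (1 : Matrix (Fin 2) (Fin 2) R)) (b • (1 : Matrix (Fin 1) (Fin 1) R)))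
    {M : Matrix (Fin 3) (Fin 3) R} (hHP : ((P : Matrix (Fin 3) (Fin 3) R).map σ)ᵀ * H * (P : Matrix (Fin 3) (Fin 3) R) = M) :
    kottwitzSign σ H X = kottwitzSign σ M (Matrix.diagonal ![a, a, b]) := by
  have hPi : ((P⁻¹ : GL (Fin 3) R) : Matrix (Fin 3) (Fin 3) R) * (P : Matrix (Fin 3) (Fin 3) R) = 1 := by
    rw [← Units.val_mul, inv_mul_cancel, Units.val_one]
  have hD : ((P⁻¹ : GL (Fin 3) R) : Matrix (Fin 3) (Fin 3) R) * X * (P : Matrix (Fin 3) (Fin 3) R) = Matrix.diagonal ![a, a, b] := by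
    rw [Matrix.mul_assoc, hXP, ← Matrix.mul_assoc, hPi, Matrix.one_mul, finSum_smul_one_eq_diagonal]
  rw [← hD, ← hHP, kottwitzSign_congr]

/-- **THE SIGN OF A FRAMED ELEMENT WITH A BLOCK GRAM MATRIX over a field**: `X P = P (a·1₂ ⊕ᶠ b·1₁)`, `ᵗ(σP) H P = B ⊕ᶠ C` with `B` `σ`-hermitian
and `C₀₀ ≠ 0` ⇒ `e_H(X) = −1 ↔ −det B is not a norm`. [cite: Rogawski1990, §4.1 (4.1.2) pp. 39–40; §8.2 p. 117] [cite: Kottwitz1986, §9] -/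
theorem kottwitzSign_eq_neg_one_iff_of_frame_finSum {K : Type*} [Field K] (τ : K →+* K) (H : Matrix (Fin 3) (Fin 3) K) {X : Matrix (Fin 3) (Fin 3) K}
    (P : GL (Fin 3) K) {a b : K} (hab : IsUnit (a - b))
    (hXP : X * (P : Matrix (Fin 3) (Fin 3) K) =
      (P : Matrix (Fin 3) (Fin 3) K) * finSum 2 1 (a • (1 : Matrix (Fin 2) (Fin 2) K)) (b • (1 : Matrix (Fin 1) (Fin 1) K)))
    {B : Matrix (Fin 2) (Fin 2) K} {C : Matrix (Fin 1) (Fin 1) K}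
    (hHP : ((P : Matrix (Fin 3) (Fin 3) K).map τ)ᵀ * H * (P : Matrix (Fin 3) (Fin 3) K) = finSum 2 1 B C)
    (hB : (B.map τ)ᵀ = B) (hC : C 0 0 ≠ 0) :
    kottwitzSign τ H X = -1 ↔ ¬ ∃ z : K, τ z * z = -B.det := by
  rw [kottwitzSign_eq_of_frame' τ H P hXP hHP, kottwitzSign_finSum_diagonal_eq_neg_one_iff τ hab hB hC]

end Frame

end Literature.NumberTheory.Rogawski1990

end
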